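import Mathlib.Analysis.CStarAlgebra.Matrix
import Mathlib.Analysis.InnerProductSpace.Adjoint
import Mathlib.LinearAlgebra.Matrix.Adjugate
import Mathlib.Topology.Algebra.MvPolynomial
import Mathlib.Analysis.Complex.Basic
import Literature.Analysis.OperatorTheory.ContractiveDeterminantalRepresentation
import Literature.Analysis.OperatorTheory.ContractiveDeterminantalRepresentationProofs
import Literature.Analysis.OperatorTheory.ContractiveDetComplexity
import HarnessLib

/-!
# The Schur bound for unitary transfer-function realizations

Topic `Literature/Analysis/OperatorTheory`; companion of `ContractiveDeterminantalRepresentation`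
(vocabulary of Grinshpan–Kaliuzhnyi-Verbovetskyi–Woerdeman, *Norm-constrained determinantal
representations of multivariable polynomials*, Complex Anal. Oper. Theory 7 (2013) =
arXiv:1208.2288 [GrinshpanKaliuzhnyiverbovetsWoerdeman2012], (1.5): transfer-function realizations
`f = A + B Z_m (I − D Z_m)⁻¹ C` by a unitary `U = [[A, B], [C, D]]`, rendered in the tree as the
cleared-denominator identity `IsRealizedBy κ U num den`).  Requested by the prover of crux
`ValiantsHypothesis/ContractivityPrice.ContractiveHardness` (line `birth`, stub
`stub_realizationHardness`), where every NON-existence statement about unitary realizations starts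
from the bound proved here.

If a unitary colligation `U = [[A, B], [C, D]] ∈ ℂ^{(1+R)×(1+R)}` realizes the rational function
`num/den` with block structure `κ : Fin R → σ` (`IsRealizedBy κ U num den`, the tree's rendering of
[GKVW 2012, (1.5)] `num/den = A + B Z (I − D Z)⁻¹ C`, `Z = diag(z_{κ i})`), then `num/den` is a
SCHUR function: `|num(z)| ≤ |den(z)|` at every point `z` of the closed unit polydisc.  This is the
standard colligation computation (`U` is an isometry, so with `x = (I − D Z(z))⁻¹ C`,
`|f(z)|² + ‖x‖² = 1 + ‖Z(z) x‖² ≤ 1 + ‖x‖²`), followed by a continuity argument from the open to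
the closed polydisc.  It is the elementary half of "transfer functions of unitary colligations
are (inner) Schur–Agler functions" (Agler 1990; [GKVW 2012, §1, (1.3)–(1.5)]): the von Neumann /
Schur–Agler inequality `‖f(T)‖ ≤ 1` specialised to scalar points `T = z ∈ 𝔻^d`, which needs no
functional calculus and no Schur–Agler class (route definition request D2, not in the tree).

Main results:
* `IsRealizedBy.eval_mul_det_eq` — the realization identity evaluated at a point;
* `IsRealizedBy.norm_eval_le_of_norm_lt_one` — `|num(z)| ≤ |den(z)|` on the open polydisc;
* `IsRealizedBy.norm_eval_le` — the same on the closed polydisc.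

Not here: the boundary identity `|f| = 1` a.e. on the torus (inner), and anything about
operator tuples `T` (the Schur–Agler class itself).
-/

noncomputable section

namespace Literature.Analysis.OperatorTheory

open MvPolynomial Matrix
open _root_.Topology

variable {σ : Type*} {R : ℕ}

/-! ## Evaluating the realization identity -/

/-- Evaluating the block variable matrix: `Z_κ(z) = diag(z_{κ i})`. [folklore] -/
theorem blockVar_map_eval (κ : Fin R → σ) (z : σ → ℂ) :
    (blockVar κ).map (MvPolynomial.eval z) = Matrix.diagonal (fun i => z (κ i)) := by
  rw [blockVar, Matrix.diagonal_map (map_zero _)]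
  simp

/-- Evaluating a matrix of constants: `(K.map C).map (eval z) = K`. [folklore] -/
theorem map_C_map_eval {m n : Type*} (K : Matrix m n ℂ) (z : σ → ℂ) :
    (K.map (MvPolynomial.C : ℂ → MvPolynomial σ ℂ)).map (MvPolynomial.eval z) = K := by
  rw [Matrix.map_map]
  convert Matrix.map_id K
  funext a
  simp

/-- Evaluating the state pencil: `(I − D Z_κ)(z) = I − D · diag(z_{κ i})`. [folklore] -/
theorem pencil_map_eval (κ : Fin R → σ) (D : Matrix (Fin R) (Fin R) ℂ) (z : σ → ℂ) :
    (1 - D.map (MvPolynomial.C : ℂ → MvPolynomial σ ℂ) * blockVar κ).map (MvPolynomial.eval z) =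
      1 - D * Matrix.diagonal (fun i => z (κ i)) := by
  rw [Matrix.map_sub _ (map_sub (MvPolynomial.eval z)),
    Matrix.map_one _ (map_zero _) (map_one _), Matrix.map_mul, map_C_map_eval, blockVar_map_eval]

/-- **The realization identity at a point.** If `U = [[A, B], [C, D]]` realizes `num/den` with block
structure `κ`, then for every `z`, with `Z = diag(z_{κ i})` and `M = I − D Z`,
`num(z) · det M = den(z) · (A · det M + (B Z adj(M) C)₀₀)`.
[cite: GrinshpanKaliuzhnyiverbovetsWoerdeman2012, (1.5)] -/
theorem IsRealizedBy.eval_mul_det_eq {κ : Fin R → σ} {U : Matrix (Fin 1 ⊕ Fin R) (Fin 1 ⊕ Fin R) ℂ}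
    {num den : MvPolynomial σ ℂ} (h : IsRealizedBy κ U num den) (z : σ → ℂ) :
    MvPolynomial.eval z num * (1 - U.toBlocks₂₂ * Matrix.diagonal (fun i => z (κ i))).det =
      MvPolynomial.eval z den *
        (U (Sum.inl 0) (Sum.inl 0) * (1 - U.toBlocks₂₂ * Matrix.diagonal (fun i => z (κ i))).det +
          (U.toBlocks₁₂ * Matrix.diagonal (fun i => z (κ i)) *
              (1 - U.toBlocks₂₂ * Matrix.diagonal (fun i => z (κ i))).adjugate *
            U.toBlocks₂₁) 0 0) := by
  have h0 := h
  unfold IsRealizedBy at h0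
  dsimp only at h0
  have h' := congrArg (MvPolynomial.eval z) h0
  simp only [map_mul, map_add] at h'
  rw [RingHom.map_det, RingHom.mapMatrix_apply, pencil_map_eval] at h'
  have hA : MvPolynomial.eval z (((U.toBlocks₁₁).map (C : ℂ → MvPolynomial σ ℂ)) 0 0) =
      U (Sum.inl 0) (Sum.inl 0) := by
    simp [Matrix.toBlocks₁₁]
  have hBmat : ((U.toBlocks₁₂).map (C : ℂ → MvPolynomial σ ℂ) * blockVar κ *
        (1 - (U.toBlocks₂₂).map (C : ℂ → MvPolynomial σ ℂ) * blockVar κ).adjugate *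
        (U.toBlocks₂₁).map (C : ℂ → MvPolynomial σ ℂ)).map (MvPolynomial.eval z) =
      U.toBlocks₁₂ * Matrix.diagonal (fun i => z (κ i)) *
          (1 - U.toBlocks₂₂ * Matrix.diagonal (fun i => z (κ i))).adjugate * U.toBlocks₂₁ := by
    rw [Matrix.map_mul, Matrix.map_mul, Matrix.map_mul, map_C_map_eval, map_C_map_eval,
      blockVar_map_eval, ← RingHom.mapMatrix_apply (MvPolynomial.eval z), RingHom.map_adjugate,
      RingHom.mapMatrix_apply, pencil_map_eval]
  have hB := congrFun (congrFun hBmat 0) 0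
  rw [Matrix.map_apply] at hB
  rw [hA, hB] at h'
  exact h'

/-! ## The colligation estimate -/

/-- The state pencil `I − D Z(z)` of a unitary colligation is invertible at every point of the
open unit polydisc (`D` is a contraction, `‖Z(z)‖ < 1`). [folklore] -/
theorem det_pencil_ne_zero_of_unitary {κ : Fin R → σ} {U : Matrix (Fin 1 ⊕ Fin R) (Fin 1 ⊕ Fin R) ℂ}
    (hU : U ∈ Matrix.unitaryGroup (Fin 1 ⊕ Fin R) ℂ) {z : σ → ℂ} (hz : ∀ j, ‖z j‖ < 1) :
    (1 - U.toBlocks₂₂ * Matrix.diagonal (fun i => z (κ i))).det ≠ 0 := by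
  have hD : IsContraction (-U.toBlocks₂₂) :=
    (isContraction_neg_iff _).mpr (isContraction_toBlocks₂₂ hU)
  have h := det_one_add_diagonal_mul_ne_zero (-U.toBlocks₂₂) hD (fun i => z (κ i)) fun i => hz (κ i)
  rwa [Matrix.mul_neg, ← sub_eq_add_neg, ← Matrix.det_one_sub_mul_comm] at h

/-- **Colligation estimate.** For a unitary `U = [[A, B], [C, D]]` on `ℂ ⊕ ℂ^R` and a diagonal
`Z = diag(d)` with `|d i| ≤ 1`, if `x` solves the state equation `x = C + D Z x` then the output
`f = A + B Z x` satisfies `|f| ≤ 1`: indeed `U (1, Z x) = (f, x)` and `U` is an isometry, so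
`|f|² + ‖x‖² = 1 + ‖Z x‖² ≤ 1 + ‖x‖²`. [folklore] -/
theorem norm_output_le_one_of_unitary {U : Matrix (Fin 1 ⊕ Fin R) (Fin 1 ⊕ Fin R) ℂ}
    (hU : U ∈ Matrix.unitaryGroup (Fin 1 ⊕ Fin R) ℂ) (d : Fin R → ℂ) (hd : ∀ i, ‖d i‖ ≤ 1)
    (x : Fin R → ℂ)
    (hx : ∀ i, x i = U (Sum.inr i) (Sum.inl 0) + ∑ j, U (Sum.inr i) (Sum.inr j) * (d j * x j)) :
    ‖U (Sum.inl 0) (Sum.inl 0) + ∑ j, U (Sum.inl 0) (Sum.inr j) * (d j * x j)‖ ≤ 1 := by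
  set f : ℂ := U (Sum.inl 0) (Sum.inl 0) + ∑ j, U (Sum.inl 0) (Sum.inr j) * (d j * x j) with hf
  -- the input vector `(1, Z x)` and its image `(f, x)` under `U`
  set v : Fin 1 ⊕ Fin R → ℂ := Sum.elim (fun _ => 1) (fun j => d j * x j) with hv
  have hUv : U *ᵥ v = Sum.elim (fun _ => f) x := by
    funext k
    rcases k with k | i
    · have hk : k = 0 := Subsingleton.elim _ _
      subst hk
      simp [hv, hf, Matrix.mulVec, dotProduct, Fintype.sum_sum_type]
    · simp [hv, hx i, Matrix.mulVec, dotProduct, Fintype.sum_sum_type]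
  -- `U` is an isometry of `ℓ²`
  set w : EuclideanSpace ℂ (Fin 1 ⊕ Fin R) := WithLp.toLp 2 v with hw
  have hu : Matrix.toEuclideanCLM (n := Fin 1 ⊕ Fin R) (𝕜 := ℂ) U ∈
      unitary (EuclideanSpace ℂ (Fin 1 ⊕ Fin R) →L[ℂ] EuclideanSpace ℂ (Fin 1 ⊕ Fin R)) :=
    Unitary.map_mem _ hU
  have hnorm : ‖Matrix.toEuclideanCLM (n := Fin 1 ⊕ Fin R) (𝕜 := ℂ) U w‖ = ‖w‖ :=
    ContinuousLinearMap.norm_map_of_mem_unitary hu w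
  have himg : Matrix.toEuclideanCLM (n := Fin 1 ⊕ Fin R) (𝕜 := ℂ) U w =
      WithLp.toLp 2 (Sum.elim (fun _ => f) x) := by
    apply WithLp.ofLp_injective 2
    rw [Matrix.ofLp_toEuclideanCLM, hw]
    simpa using hUv
  rw [himg] at hnorm
  have hsq := congrArg (fun r : ℝ => r ^ 2) hnorm
  simp only [EuclideanSpace.norm_sq_eq, Fintype.sum_sum_type, Finset.univ_unique,
    Finset.sum_singleton, hw, hv, Sum.elim_inl, Sum.elim_inr, norm_mul,
    norm_one, one_pow] at hsq
  -- `hsq : ‖f‖² + Σ ‖x i‖² = 1 + Σ (‖d i‖ ‖x i‖)²`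
  have hZx : ∑ i, (‖d i‖ * ‖x i‖) ^ 2 ≤ ∑ i, ‖x i‖ ^ 2 := by
    refine Finset.sum_le_sum fun i _ => ?_
    have h2 : ‖d i‖ * ‖x i‖ ≤ ‖x i‖ := mul_le_of_le_one_left (norm_nonneg _) (hd i)
    exact pow_le_pow_left₀ (by positivity) h2 2
  have hf2 : ‖f‖ ^ 2 ≤ 1 := by linarith
  exact (sq_le_one_iff₀ (norm_nonneg f)).mp hf2

/-- **Schur bound on the open polydisc.** If a unitary `U` realizes `num/den` with block structure
`κ`, then `|num(z)| ≤ |den(z)|` whenever all `|z_j| < 1` (the scalar case `T = z` of the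
Schur–Agler inequality (1.3) for the transfer function (1.5)).
[cite: GrinshpanKaliuzhnyiverbovetsWoerdeman2012, (1.3)–(1.5)] -/
theorem IsRealizedBy.norm_eval_le_of_norm_lt_one {κ : Fin R → σ}
    {U : Matrix (Fin 1 ⊕ Fin R) (Fin 1 ⊕ Fin R) ℂ} (hU : U ∈ Matrix.unitaryGroup (Fin 1 ⊕ Fin R) ℂ)
    {num den : MvPolynomial σ ℂ} (h : IsRealizedBy κ U num den) {z : σ → ℂ}
    (hz : ∀ j, ‖z j‖ < 1) :
    ‖MvPolynomial.eval z num‖ ≤ ‖MvPolynomial.eval z den‖ := by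
  have hid := h.eval_mul_det_eq z
  have hdet : (1 - U.toBlocks₂₂ * Matrix.diagonal (fun i => z (κ i))).det ≠ 0 :=
    det_pencil_ne_zero_of_unitary (κ := κ) hU hz
  set d : Fin R → ℂ := fun i => z (κ i) with hd
  set D : Matrix (Fin R) (Fin R) ℂ := U.toBlocks₂₂ with hD
  set M : Matrix (Fin R) (Fin R) ℂ := 1 - D * Matrix.diagonal d with hM
  have hMunit : IsUnit M.det := isUnit_iff_ne_zero.mpr hdet
  -- the state vector `x = M⁻¹ C` (as a column matrix `X`)
  set X : Matrix (Fin R) (Fin 1) ℂ := M⁻¹ * U.toBlocks₂₁ with hX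
  have hMX : M * X = U.toBlocks₂₁ := by
    rw [hX, Matrix.mul_nonsing_inv_cancel_left _ _ hMunit]
  set x : Fin R → ℂ := fun i => X i 0 with hx
  have hstate : ∀ i, x i = U (Sum.inr i) (Sum.inl 0) +
      ∑ j, U (Sum.inr i) (Sum.inr j) * (d j * x j) := by
    intro i
    have hi := congrFun (congrFun hMX i) 0
    rw [Matrix.mul_apply] at hi
    have hsum : ∑ k, M i k * X k 0 = x i - ∑ j, U (Sum.inr i) (Sum.inr j) * (d j * x j) := by
      simp only [hM, Matrix.sub_apply, Matrix.one_apply, Matrix.mul_diagonal, sub_mul, ite_mul,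
        one_mul, zero_mul, Finset.sum_sub_distrib, Finset.sum_ite_eq, Finset.mem_univ, if_true, hx]
      congr 1
      refine Finset.sum_congr rfl fun j _ => ?_
      simp [hD, Matrix.toBlocks₂₂]
      ring
    rw [hsum] at hi
    have hC : U.toBlocks₂₁ i 0 = U (Sum.inr i) (Sum.inl 0) := by simp [Matrix.toBlocks₂₁]
    rw [hC] at hi
    linear_combination hi
  have hf := norm_output_le_one_of_unitary hU d (fun i => (hz (κ i)).le) x hstate
  -- the adjugate form: `adj(M) C = det M • X`
  have hadj : M.adjugate * U.toBlocks₂₁ = M.det • X := by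
    rw [← hMX, ← Matrix.mul_assoc, Matrix.adjugate_mul, Matrix.smul_mul, Matrix.one_mul]
  have hentry : (U.toBlocks₁₂ * Matrix.diagonal d * M.adjugate * U.toBlocks₂₁) 0 0 =
      M.det * ∑ j, U (Sum.inl 0) (Sum.inr j) * (d j * x j) := by
    rw [Matrix.mul_assoc, hadj, Matrix.mul_smul, Matrix.smul_apply, smul_eq_mul, Matrix.mul_apply]
    congr 1
    refine Finset.sum_congr rfl fun j _ => ?_
    rw [Matrix.mul_diagonal]
    simp [Matrix.toBlocks₁₂, hx]
    ring
  set f : ℂ := U (Sum.inl 0) (Sum.inl 0) + ∑ j, U (Sum.inl 0) (Sum.inr j) * (d j * x j) with hfd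
  have hid' : MvPolynomial.eval z num * M.det = MvPolynomial.eval z den * f * M.det := by
    rw [hid, hentry, hfd]
    ring
  have hcancel : MvPolynomial.eval z num = MvPolynomial.eval z den * f :=
    mul_right_cancel₀ hdet hid'
  calc ‖MvPolynomial.eval z num‖ = ‖MvPolynomial.eval z den‖ * ‖f‖ := by rw [hcancel, norm_mul]
    _ ≤ ‖MvPolynomial.eval z den‖ * 1 := by gcongr
    _ = ‖MvPolynomial.eval z den‖ := mul_one _

/-- **Schur bound on the closed polydisc.** If a unitary `U` realizes `num/den` with block
structure `κ`, then `|num(z)| ≤ |den(z)|` whenever all `|z_j| ≤ 1` (from the open polydisc by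
continuity along `t ↦ t • z`, `t ↑ 1`). [cite: GrinshpanKaliuzhnyiverbovetsWoerdeman2012, (1.3)–(1.5)] -/
theorem IsRealizedBy.norm_eval_le {κ : Fin R → σ}
    {U : Matrix (Fin 1 ⊕ Fin R) (Fin 1 ⊕ Fin R) ℂ} (hU : U ∈ Matrix.unitaryGroup (Fin 1 ⊕ Fin R) ℂ)
    {num den : MvPolynomial σ ℂ} (h : IsRealizedBy κ U num den) {z : σ → ℂ}
    (hz : ∀ j, ‖z j‖ ≤ 1) :
    ‖MvPolynomial.eval z num‖ ≤ ‖MvPolynomial.eval z den‖ := by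
  -- along the ray `t • z`, `0 ≤ t < 1`, the open-polydisc bound holds
  have hray : ∀ t : ℝ, t ∈ Set.Ico (0 : ℝ) 1 →
      ‖MvPolynomial.eval ((t : ℂ) • z) num‖ ≤ ‖MvPolynomial.eval ((t : ℂ) • z) den‖ := by
    intro t ht
    refine h.norm_eval_le_of_norm_lt_one hU fun j => ?_
    rw [Pi.smul_apply, smul_eq_mul, norm_mul, Complex.norm_real, Real.norm_eq_abs,
      abs_of_nonneg ht.1]
    calc t * ‖z j‖ ≤ t * 1 := by gcongr; exacts [ht.1, hz j]
      _ < 1 := by rw [mul_one]; exact ht.2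
  -- both sides are continuous in `t`; pass to the limit `t ↑ 1`
  have hcont : ∀ p : MvPolynomial σ ℂ,
      Continuous fun t : ℝ => ‖MvPolynomial.eval ((t : ℂ) • z) p‖ := by
    intro p
    refine continuous_norm.comp ?_
    have hc : Continuous fun t : ℝ => ((t : ℂ) • z : σ → ℂ) :=
      continuous_pi fun j => (Complex.continuous_ofReal.smul continuous_const)
    exact (MvPolynomial.continuous_eval p).comp hc
  have hlim : ∀ p : MvPolynomial σ ℂ, Filter.Tendsto (fun t : ℝ => ‖MvPolynomial.eval ((t : ℂ) • z) p‖)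
      (nhdsWithin 1 (Set.Ico 0 1)) (nhds ‖MvPolynomial.eval z p‖) := by
    intro p
    have := ((hcont p).tendsto 1).mono_left (nhdsWithin_le_nhds (s := Set.Ico (0 : ℝ) 1))
    simpa using this
  haveI : (nhdsWithin (1 : ℝ) (Set.Ico 0 1)).NeBot := by
    rw [← mem_closure_iff_nhdsWithin_neBot, closure_Ico zero_ne_one]
    norm_num
  exact le_of_tendsto_of_tendsto (hlim num) (hlim den)
    (eventually_nhdsWithin_of_forall fun t ht => hray t ht)

end Literature.Analysis.OperatorTheory

end
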